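import Summits.HodgeConjecture.HodgeConjecture.Cruxes.BlochSeedDiscOne.SeedCheckerKit
import Summits.HodgeConjecture.HodgeConjecture.Cruxes.BlochSeedDiscOne.SeedCheckerFrame
import Summits.HodgeConjecture.HodgeConjecture.Cruxes.BlochSeedDiscOne.SeedCheckerBalanced
import Summits.HodgeConjecture.HodgeConjecture.Cruxes.BlochSeedDiscOne.SeedCheckerWords
import Summits.HodgeConjecture.HodgeConjecture.Cruxes.BlochSeedDiscOne.SeedCheckerOneAnchor
import Summits.HodgeConjecture.HodgeConjecture.Cruxes.BlochSeedDiscOne.SeedCheckerMacaulay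
import Summits.HodgeConjecture.HodgeConjecture.Cruxes.BlochSeedDiscOne.SeedCheckerZeroLocus
import Summits.HodgeConjecture.HodgeConjecture.Cruxes.BlochSeedDiscOne.SeedCheckerHighTwist
import Summits.HodgeConjecture.HodgeConjecture.Cruxes.BlochSeedDiscOne.SeedCheckerSmooth
import Summits.HodgeConjecture.HodgeConjecture.Cruxes.BlochSeedDiscOne.SeedCheckerBlochAdjugate
import Summits.HodgeConjecture.HodgeConjecture.Cruxes.BlochSeedDiscOne.SeedCheckerTwistRay
import HarnessLib

/-!
# Seed checker v27 — `SeedCheckerJoint.lean`: THE JOINT-IMPORT BRIDGES, KERNEL-CHECKED (hsemireg-c5c8-1 g26, 2026-08-30)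

Crux workfile for `stmt-HodgeConjecture-18881` (`EightfoldBlochSeeds.BlochSeedDiscOne := HasHyperbolicBlochSeed 4 1`); D-0145 token
`line stmt-HodgeConjecture-18881 Cruxes/BlochSeedDiscOne/Lines/birth.lean 814a6a70c14e831a stub_rung_pad4_seedAt`. Explicit unit
`hsemireg-c5c8-1` (director-hodge MINT block A5: «C5–C8 seed checker typing spec — (σ) Hodge-class check, (A1)-cleanliness AT THE SEED,
pad4-tower compatibility with `stub_rung_pad4_seedAt`'s binders, disc-one — as predicates on (design json, presentation); flag the
vacuous ∕ implied ones»), closing generation g26 (the unit was declared COMPLETE by director R19.520).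

## §27.0 Honest framing (read first)

NOTHING here is proved toward HC ∕ HC_CM ∕ HC_AV ∕ №4 ∕ 26512 ∕ 18881 ∕ H2. No design, kit, bundle, section, zero scheme or seed is
constructed; `stub_rung_pad4_seedAt`, the line and the crux stay exactly as open as before (never restated, never weakened). This seat
produces EVIDENCE and TYPED FILES, not rungs. This file has NO mathematical content of its own: every `theorem` below is a one-line
COMPOSITION of theorems already proved in two different satellites of the seed checker that could not import each other when they were
written (each satellite v5–v22 imported only v4 `SeedChecker.lean`, the one module the farm snapshot built at the time, and RECORDED its
cross-file dictionary as «`rfl` once both are built»). The farm snapshot of 2026-08-30 (build 10:27Z) now builds v4–v22, so the recorded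
dictionaries are CHECKED here, by the kernel, for the first time — that is all v27 does. It imports only BUILT modules (v6.2 Kit, v7.1 Frame, v8
Balanced, v10 Words, v11 OneAnchor, v15.1 Macaulay, v16 ZeroLocus, v17 HighTwist, v18 Smooth, v21.1 BlochAdjugate, v22 TwistRay; NOT the
unbuilt v23 NewtonClosure ∕ v24 Alphabet ∕ v26 Compound), restates nothing under an old name, and declares no `instance`, `notation`,
`macro`, `axiom`, `sorry`; `set_option linter.dupNamespace false` only (Cruxes workfile convention v4–v26). Sub-namespace `…SeedChecker.Joint`.

## What is bridged (recorded where → checked here)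

* §27.1 **O-WF DISCHARGED** (v10 §13.5 «DICTIONARY TO v7.1 … `rfl` in any file importing both»): `xstep = cross`, `eeeeOf (eLetter ψ₀ v)
  = eeee ψ₀ v`, `eeeeOf (ebarLetter ψ₀ v) = eeeeBar ψ₀ v` (all `rfl`), hence `wordFrameOf_linksTo_normalisedFrame`: v10's CONSTRUCTED word
  frame is LINKED (v4 §6.2 `WordFrame.LinksTo`, `h = h_std`) to v7.1's CONSTRUCTED normalised Weil frame — (F1) is v10's theorem, (F2) is
  v7.1's `rfl` — `exists_linkedFrames` (on every CM anchor a linked (word frame, Weil frame) pair EXISTS) and **`wordKit_nonempty`**: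
  v4 §6.4's `WordKit E₀ ψ₀` (anchor kit + linked word frame; «data, NOT constructed here» in v4) is INHABITED on every CM anchor
  (O-W ∕ O-pol ∕ O-hyp by v6.2 `anchorKit_nonempty_of_frame`, O-WF by v10 + v7.1). The frame hypothesis `Φ.LinksTo F h_std` of the
  (A1@Z) ∕ C6 readings and of v4's three presentation doors is therefore met, not assumed: obligation O-WF of the trust base is closed.
* §27.2 **(L-int) DISCHARGED IN v17's OWN WORDS** (v18 §18.1 «in a joint build `smoothConnectedIntegral_holds : SmoothConnectedIntegral`»):
  `smoothConnectedIntegral_law : SmoothConnectedIntegral`, and v17's crux door with THREE laws instead of four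
  (`blochSeedDiscOne_of_highTwistChecks₃`: (L-conn), (L-Bert), `TopChernFourLocalisation`).
* §27.3 **C5 IS IMPLIED AT THE ZERO-SCHEME DOOR** (v15 §18 «SUCCESSOR: derive `LocallyGeneratedBy i 4` from `IsZeroSchemeOf s i ∧ HasRank 𝓕 4`»
  + v16 §19.3 «literally v15's body, so the joint file bridges by `Iff.rfl`»): `locallyGeneratedBy_of_isZeroSchemeOf'` (v16's theorem AS v15's
  predicate), `isRegularImmersionOfCodim_four_of_isZeroSchemeOf` (on `S⁴`: zero scheme of a section of a rank-`4` bundle + C6's codimension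
  clause ⟹ C5, by v15's Cohen–Macaulay theorem `isRegularImmersionOfCodim_pad4`), and the v4 lci door with `hreg` AND `hgen` GONE:
  `seedCheck_of_zeroScheme_codim` ∕ `blochSeedDiscOne_of_zeroScheme_codim` — object-side hypotheses left: C6 (integral, codimension `≥ 4`)
  and C7 (Bloch-semiregular). FLAG (sharpened): at the zero-scheme door C5 is IMPLIED by C6-codim (v15 + v16), and C6 is IMPLIED by
  C5 ∧ smooth ∧ connected (v18) — so the honest minimal object-side check list is {codimension `≥ 4`, integral (or smooth ∧ connected), C7}.
* §27.4 **v22's Bloch ray IS v21's Bloch pencil** (v22 header «`polyFamily_blochCoeff` is v21's `BlochPencil.pencilₗ …` unfolded — `rfl` once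
  v21 is built»): `polyFamily_blochCoeff_eq_pencilₗ`, hence `lciDoorGeneric_iff_exists_injective_pencilₗ` — v22's `t`-free C7-lci clause
  `LciDoorGeneric f γ₁ γ₂ γ₃` ⟺ «v21's pencil is injective at SOME twist».
* §27.5 **v11's frame hypothesis `SeparatesH4` IS v8's theorem** (v11 header «a HYPOTHESIS here; it is v8's `mu_eq_of_eq`»):
  `separatesH4_of_mem_balanced` (any balanced `h ∈ χ_{1,1}`), `separatesH4_symH` (the stub's `h_K = symH e a`, EVERY `(e, a)`),
  `separatesH4_hStd`; hence v11's «every section of a rank-`4` realisation of a design with `μ ≠ 0` vanishes somewhere, GIVEN the law»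
  with the frame hypothesis gone (`nonempty_zeroScheme_of_realisedBy_hStd`).

Not bridged here (modules unbuilt on the farm snapshot, recorded for the successor): v23's kit hypotheses `HPrimitive` ∕ `FrameGram 2` ∕
`h⁸ ≠ 0` ⟸ v13 ∕ v14 ∕ v12; v26 `WeilFrame.overScale` = v24 `WeilFrame.atScale`; v24 flag (iv) (R4 at scale `L`).

[cite: HatcherAT2002, §3.2 (Künneth, Thm. 3.16)] [cite: vanGeemen1994HodgeAV, Thm. 6.12 and its proof] [cite: Fulton1998, B.3.2, B.3.4, Example 14.1.1]
[cite: GortzWedhorn2020, Prop. 3.27 and Exercise 3.16] [cite: BuchweitzFlenner2003, Prop. 8.2, Lemma 8.4] [cite: Harris1992, Lecture 9]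
-/

noncomputable section

set_option linter.dupNamespace false

open CategoryTheory AlgebraicGeometry
open Literature.AlgebraicGeometry Literature.AlgebraicGeometry.Motives Literature.AlgebraicGeometry.HodgeTheory
open Literature.AlgebraicTopology.SingularHomology

namespace Summit.HodgeConjecture.HodgeConjecture.Cruxes.BlochSeedDiscOne.SeedChecker

open Summit.HodgeConjecture.HodgeConjecture.Cruxes.BlochSeedDiscOne.Anchor
open Summit.Ventures.HSemireg Summit.Ventures.HSemireg.Pad4Tower

namespace Joint

/-! ## §27.1 O-WF discharged: v10's word frame is linked to v7.1's normalised Weil frame -/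

section OWF

variable {E₀ : AbelianVariety ℂ} {B : AbelianVariety ℂ}

/-- v10's tower step `xstep` IS v7.1's `cross` (verbatim bodies). [cite: HatcherAT2002, §3.2] -/
theorem xstep_eq_cross {n : ℕ} (b : complexBetti B.X (2 * n)) (c : complexBetti (weilSurf E₀).X (2 * 1)) :
    xstep b c = cross b c :=
  rfl

variable (ψ₀ : E₀ ⟶ E₀) (v : complexBetti E₀.X 1)

/-- **`e ⊠ e ⊠ e ⊠ e` of v10 IS `eeee` of v7.1.** [cite: vanGeemen1994HodgeAV, proof of Thm. 6.12] -/
theorem eeeeOf_eLetter : eeeeOf (eLetter ψ₀ v) = eeee ψ₀ v :=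
  rfl

/-- **`ē ⊠ ē ⊠ ē ⊠ ē` of v10 IS `eeeeBar` of v7.1.** -/
theorem eeeeOf_ebarLetter : eeeeOf (ebarLetter ψ₀ v) = eeeeBar ψ₀ v :=
  rfl

variable {ψ₀} {v}

/-- **O-WF (a word frame LINKED to the Weil frame, `h = h_std`) — DISCHARGED**: v10's constructed word frame on the letters
`e = eLetter ψ₀ v`, `ē = ebarLetter ψ₀ v` is linked (v4 §6.2 `WordFrame.LinksTo`) to v7.1's normalised Weil frame built from the same
rational `v ≠ 0`; (F1) = v10 `wordFrameOf_sum_eFree`, (F2) = v7.1 `normalisedFrame_rOne ∕ _rTwo` (definitional).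
[cite: HatcherAT2002, §3.2] [cite: vanGeemen1994HodgeAV, 4.9–4.11 and Thm. 6.12] -/
theorem wordFrameOf_linksTo_normalisedFrame (hE : E₀.dim = 1) (hψ : ψ₀ ≫ ψ₀ = -(1 • 𝟙 E₀)) (hv : IsRationalClass v)
    (hv0 : v ≠ 0) (η : complexBetti E₀.X 2) :
    (wordFrameOf η (eLetter ψ₀ v) (ebarLetter ψ₀ v)).LinksTo (normalisedFrame hE hψ hv hv0) (hStd E₀ η) :=
  wordFrameOf_linksTo η (eLetter ψ₀ v) (ebarLetter ψ₀ v) hE (normalisedFrame hE hψ hv hv0)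
    (normalisedFrame_rOne hE hψ hv hv0) (normalisedFrame_rTwo hE hψ hv hv0)

/-- **ON EVERY CM ANCHOR A LINKED (word frame, Weil frame) PAIR EXISTS** (`h = h_std`, any `η`): the frame hypothesis
`Φ.LinksTo F h_std` of the (A1@Z) ∕ C6 readings (v4 `classCheck_iff_coords`, v7.1 `bottomRow_iff_period_of_frame`, v9 `descent_checklist`)
is INHABITED. A rational `v ≠ 0` in `H¹(E₀(ℂ); ℂ)` exists by the tree's `exists_isRationalClass_ne_zero_one`. -/
theorem exists_linkedFrames (hE : E₀.dim = 1) (hψ : ψ₀ ≫ ψ₀ = -(1 • 𝟙 E₀)) (η : complexBetti E₀.X 2) :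
    ∃ (Φ : WordFrame E₀) (F : WeilFrame E₀ ψ₀), Φ.LinksTo F (hStd E₀ η) := by
  obtain ⟨v, hv, hv0⟩ := exists_isRationalClass_ne_zero_one hE
  exact ⟨_, _, wordFrameOf_linksTo_normalisedFrame hE hψ hv hv0 η⟩

/-- **THE WORD KIT (v4 §6.4 `WordKit`: anchor kit + a word frame LINKED to `(h_std, r₁, r₂)`) EXISTS ON EVERY CM ANCHOR** —
O-W ∕ O-pol ∕ O-hyp by v6.2 (`anchorKit_nonempty`, `anchorKit_nonempty_of_frame` with v7.1's normalised frame), O-WF by §27.1.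
v4 declared `WordKit` «a structure (data), NOT constructed here»; after v27 no presentation door of v4 §6.4
(`hasHyperbolicBFSheafSeedOn_of_kernelPresentation ∕ …cokernel… ∕ …monad…`, `Design.seedCheck_of_twistedKernelPresentation`) quantifies
over an empty type on the anchor + frame side. What those doors cost is the DESIGN (C0) and the OBJECT (presentation, C5–C7, the law). -/
theorem wordKit_nonempty (hE : E₀.dim = 1) (hψ : ψ₀ ≫ ψ₀ = -(1 • 𝟙 E₀)) : Nonempty (WordKit E₀ ψ₀) := by
  obtain ⟨v, hv, hv0⟩ := exists_isRationalClass_ne_zero_one hE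
  obtain ⟨K₀⟩ := anchorKit_nonempty hE hψ
  obtain ⟨K, -, hKF⟩ := anchorKit_nonempty_of_frame hE hψ K₀.η_rational K₀.η_ne_zero (normalisedFrame hE hψ hv hv0)
  refine ⟨⟨K, wordFrameOf K.η (eLetter ψ₀ v) (ebarLetter ψ₀ v), ?_⟩⟩
  rw [hKF]
  exact wordFrameOf_linksTo_normalisedFrame hE hψ hv hv0 K.η

end OWF

/-! ## §27.2 (L-int) discharged in v17's own words; the high-twist crux door with three laws -/

section LInt

/-- **(L-int) AS v17 STATES IT, PROVED** — v18's `smoothConnectedIntegral_holds` has v17's `def SmoothConnectedIntegral` as its type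
(definitional unfolding). [cite: GortzWedhorn2020, Prop. 3.27 and Exercise 3.16] -/
theorem smoothConnectedIntegral_law : SmoothConnectedIntegral :=
  smoothConnectedIntegral_holds

variable {C : ChernCharacterBetti}

/-- **v17's crux door `blochSeedDiscOne_of_highTwistChecks` WITH (L-int) DROPPED**: laws left = (L-conn) `HighTwistConnectedness`,
(L-Bert) `HighTwistBertini`, `TopChernFourLocalisation C`; plus, per CM anchor, a (design, kit, bundle, ample divisor) passing
`Design.HighTwistCheck` — data no one has constructed (hypothesis-carrying; concludes the crux BY NAME). -/
theorem blochSeedDiscOne_of_highTwistChecks₃ (hconn : HighTwistConnectedness) (hbert : HighTwistBertini)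
    (hloc : TopChernFourLocalisation C)
    (h : ∀ (E₀ : AbelianVariety ℂ) (ψ₀ : E₀ ⟶ E₀), E₀.dim = 1 → ψ₀ ≫ ψ₀ = -(1 • 𝟙 E₀) →
      haveI := pad4Anchor_isIntegral E₀
      ∃ (D : Design) (K : AnchorKit E₀ ψ₀) (𝓔 : (pad4Anchor E₀).X.left.Modules)
        (Θ : CartierDivisor (pad4Anchor E₀).X.left), D.HighTwistCheck C K 𝓔 Θ) :
    Summit.HodgeConjecture.HodgeConjecture.Theses.EightfoldBlochSeeds.BlochSeedDiscOne :=
  blochSeedDiscOne_of_highTwistChecks hconn hbert smoothConnectedIntegral_holds hloc h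

end LInt

/-! ## §27.3 C5 at the zero-scheme door is implied by C6's codimension clause (v15 Macaulay + v16 ZeroLocus) -/

section CFive

variable {X : Scheme.{0}} {𝓕 : X.Modules} {r : ℕ}

/-- **v15's hypothesis `LocallyGeneratedBy i r`, DISCHARGED for every zero scheme of a section of a rank-`r` bundle** (v16's
`locallyGeneratedBy_of_isZeroSchemeOf`, whose statement is v15's predicate unfolded). [cite: Fulton1998, B.3.2 (PDF p. 410)] -/
theorem locallyGeneratedBy_of_isZeroSchemeOf' (hr : HasRank 𝓕 r) {s : Modules.unitModule X ⟶ 𝓕} {Z : Scheme.{0}} {i : Z ⟶ X}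
    (hZ : IsZeroSchemeOf s i) : Macaulay.LocallyGeneratedBy i r :=
  ZeroLocus.locallyGeneratedBy_of_isZeroSchemeOf hr hZ

variable {E₀ : AbelianVariety ℂ} {ψ₀ : E₀ ⟶ E₀} {C : ChernCharacterBetti}

/-- **C5 ⟸ C6-codim AT THE ZERO-SCHEME DOOR ON `S⁴`**: the zero scheme `i : Z ↪ S⁴` of a section of a rank-`4` bundle whose image has
codimension `≥ 4` pointwise IS a regular immersion of codimension `4` (`S⁴` is regular, hence Cohen–Macaulay: v15
`isRegularImmersionOfCodim_pad4`; the `4` local equations are the frame coordinates of the section: v16). [cite: Fulton1998, B.3.4]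
[cite: BrunsHerzog1993, Thm. 2.1.2] -/
theorem isRegularImmersionOfCodim_four_of_isZeroSchemeOf {𝓕 : (pad4Anchor E₀).X.left.Modules} (hrk : HasRank 𝓕 4)
    {s : Modules.unitModule (pad4Anchor E₀).X.left ⟶ 𝓕} {Z : Scheme.{0}} {i : Z ⟶ (pad4Anchor E₀).X.left}
    (hZ : IsZeroSchemeOf s i) (hcoh : ∀ z ∈ Set.range i.base, ((4 : ℕ) : ℕ∞) ≤ Order.coheight z) :
    IsRegularImmersionOfCodim i 4 := by
  haveI := hZ.isClosedImmersion
  exact Macaulay.isRegularImmersionOfCodim_pad4 (locallyGeneratedBy_of_isZeroSchemeOf' hrk hZ) hcoh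

/-- **THE v4 ZERO-SCHEME DOOR WITH C5 GONE** (`hreg` of v4 `Design.seedCheck_of_zeroScheme` and `hgen` of v15
`seedCheck_of_zeroScheme_generators` both discharged): GIVEN the law `TopChernFourLocalisation C`, a design passing C0, a kit, a rank-`4`
bundle (A1)-clean at the seed with the design's `μ` in a window `⊇ {1,2,3}`, and a section whose zero scheme is INTEGRAL, of CODIMENSION
`≥ 4` pointwise, and BLOCH-SEMIREGULAR ⟹ `D.SeedCheck K i q` for some `q`. Hypothesis-carrying; nothing constructed. -/
theorem seedCheck_of_zeroScheme_codim (D : Design) (hE : E₀.dim = 1) (hψ : ψ₀ ≫ ψ₀ = -(1 • 𝟙 E₀)) (hC0 : D.ClassData)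
    (K : AnchorKit E₀ ψ₀) {I : Finset ℕ} {𝓕 : (pad4Anchor E₀).X.left.Modules} (hloc : TopChernFourLocalisation C)
    (hrk : HasRank 𝓕 4) (hcl : CleanAtSeed C I K.F (hStd E₀ K.η) 𝓕 D.mu) (h1 : 1 ∈ I) (h2 : 2 ∈ I) (h3 : 3 ∈ I)
    (s : Modules.unitModule (pad4Anchor E₀).X.left ⟶ 𝓕) {Z : Scheme.{0}} {i : Z ⟶ (pad4Anchor E₀).X.left}
    (hZ : IsZeroSchemeOf s i) (hint : AlgebraicGeometry.IsIntegral Z)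
    (hcoh : ∀ z ∈ Set.range i.base, ((4 : ℕ) : ℕ∞) ≤ Order.coheight z) (hsr : IsBlochSemiregular i (2 * 4) 4) :
    ∃ q : ℚ, D.SeedCheck K i q :=
  D.seedCheck_of_zeroScheme hE hψ hC0 K hloc hrk hcl h1 h2 h3 s hZ (isRegularImmersionOfCodim_four_of_isZeroSchemeOf hrk hZ hcoh)
    hint hcoh hsr

/-- **… AND THE CRUX BY NAME from such a zero scheme on ONE CM anchor** (v11 ∕ v15 one-anchor door). Hypothesis-carrying. -/
theorem blochSeedDiscOne_of_zeroScheme_codim (hE : E₀.dim = 1) (hψ : ψ₀ ≫ ψ₀ = -(1 • 𝟙 E₀)) {D : Design} (hC0 : D.ClassData)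
    (K : AnchorKit E₀ ψ₀) {I : Finset ℕ} {𝓕 : (pad4Anchor E₀).X.left.Modules} (hloc : TopChernFourLocalisation C)
    (hrk : HasRank 𝓕 4) (hcl : CleanAtSeed C I K.F (hStd E₀ K.η) 𝓕 D.mu) (h1 : 1 ∈ I) (h2 : 2 ∈ I) (h3 : 3 ∈ I)
    (s : Modules.unitModule (pad4Anchor E₀).X.left ⟶ 𝓕) {Z : Scheme.{0}} {i : Z ⟶ (pad4Anchor E₀).X.left}
    (hZ : IsZeroSchemeOf s i) (hint : AlgebraicGeometry.IsIntegral Z)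
    (hcoh : ∀ z ∈ Set.range i.base, ((4 : ℕ) : ℕ∞) ≤ Order.coheight z) (hsr : IsBlochSemiregular i (2 * 4) 4) :
    Summit.HodgeConjecture.HodgeConjecture.Theses.EightfoldBlochSeeds.BlochSeedDiscOne := by
  obtain ⟨q, hq⟩ := seedCheck_of_zeroScheme_codim D hE hψ hC0 K hloc hrk hcl h1 h2 h3 s hZ hint hcoh hsr
  exact Macaulay.blochSeedDiscOne_of_seedCheck_one' hE hψ hq

end CFive

/-! ## §27.4 v22's Bloch ray is v21's Bloch pencil -/

section Pencil

variable {K : Type*} [Field K] {V W : Type*} [AddCommGroup V] [Module K V] [AddCommGroup W] [Module K W]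

/-- **`Π_t` (v22 `TwistRay.polyFamily 3 (blochCoeff f γ)`) = `pencilₗ f γ t` (v21 `BlochPencil.pencilₗ`)** — the recorded `rfl`
dictionary, checked. [cite: BuchweitzFlenner2003, Prop. 8.2] -/
theorem polyFamily_blochCoeff_eq_pencilₗ (f : Fin 4 → (V →ₗ[K] W)) (γ₁ γ₂ γ₃ t : K) :
    TwistRay.polyFamily 3 (TwistRay.blochCoeff f γ₁ γ₂ γ₃) t = BlochPencil.pencilₗ f γ₁ γ₂ γ₃ t :=
  TwistRay.polyFamily_blochCoeff f γ₁ γ₂ γ₃ t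

/-- **v22's `t`-free C7-lci clause ⟺ v21's pencil is injective at some twist.** [cite: Harris1992, Lecture 9] -/
theorem lciDoorGeneric_iff_exists_injective_pencilₗ (f : Fin 4 → (V →ₗ[K] W)) (γ₁ γ₂ γ₃ : K) :
    TwistRay.LciDoorGeneric f γ₁ γ₂ γ₃ ↔ ∃ t : K, Function.Injective (BlochPencil.pencilₗ f γ₁ γ₂ γ₃ t) := by
  simp only [TwistRay.lciDoorGeneric_iff, polyFamily_blochCoeff_eq_pencilₗ]

end Pencil

/-! ## §27.5 v11's frame hypothesis `SeparatesH4` is v8's theorem -/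

section Separates

variable {E₀ : AbelianVariety ℂ} {ψ₀ : E₀ ⟶ E₀} {C : ChernCharacterBetti}

/-- **`SeparatesH4` HOLDS for every Weil frame and every BALANCED degree-two class `h ∈ χ_{1,1}`** (v8 `WeilFrame.mu_eq_of_eq`,
`WeilFrame.wOf_zero`: coordinates in `χ_{4,4} ⊕ W_K` are unique). [cite: vanGeemen1994HodgeAV, 4.9–4.11] -/
theorem separatesH4_of_mem_balanced (F : WeilFrame E₀ ψ₀) {h : complexBetti (pad4Anchor E₀).X 2}
    (hh : h ∈ pullbackEigenclasses (pad4Anchor E₀) (pad4Action E₀ ψ₀) 2 (balancedChar 1 1)) : F.SeparatesH4 h := by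
  intro s ν hν
  have h0 : s • cupPowTwo h 4 + F.wOf ν = (0 : ℂ) • cupPowTwo h 4 + F.wOf 0 := by
    rw [hν, zero_smul, zero_add, WeilFrame.wOf_zero]
  exact (F.mu_eq_of_eq hh h0).1

/-- **… in particular for the stub's `h_K = symH e a`, for EVERY projective embedding `e` and EVERY class `a`** (v8 `symH_mem_balanced`). -/
theorem separatesH4_symH (hψ : ψ₀ ≫ ψ₀ = -(1 • 𝟙 E₀)) (F : WeilFrame E₀ ψ₀) (e : ProjectiveEmbedding (pad4Anchor E₀).X)
    (a : complexBetti (projectiveSpace e.n ℂ) 2) : F.SeparatesH4 (symH (pad4Action E₀ ψ₀) e a) :=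
  separatesH4_of_mem_balanced F (symH_mem_balanced hψ e a)

/-- **… and for `h_std`** (v8 `hStd_mem_balanced`). -/
theorem separatesH4_hStd (hE : E₀.dim = 1) (hψ : ψ₀ ≫ ψ₀ = -(1 • 𝟙 E₀)) (F : WeilFrame E₀ ψ₀) (η : complexBetti E₀.X 2) :
    F.SeparatesH4 (hStd E₀ η) :=
  separatesH4_of_mem_balanced F (hStd_mem_balanced hE one_pos hψ η)

/-- **v11's «EVERY SECTION OF A RANK-`4` REALISATION OF A DESIGN WITH `μ ≠ 0` VANISHES SOMEWHERE, GIVEN THE LAW», frame hypothesis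
DISCHARGED** (against `h_std`, the frame every realisation of record is read in). The (σ) design half alone forbids a nowhere-zero
section, before any candidate exists. Hypothesis-carrying (`hloc`, `hR`). -/
theorem nonempty_zeroScheme_of_realisedBy_hStd (hE : E₀.dim = 1) (hψ : ψ₀ ≫ ψ₀ = -(1 • 𝟙 E₀)) {D : Design}
    {F : WeilFrame E₀ ψ₀} {η : complexBetti E₀.X 2} {𝓕 : (pad4Anchor E₀).X.left.Modules} (hloc : TopChernFourLocalisation C)
    (hrk : HasRank 𝓕 4) (hR : D.RealisedBy C F (hStd E₀ η) 𝓕) (hμ : D.mu ≠ 0)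
    (s : Modules.unitModule (pad4Anchor E₀).X.left ⟶ 𝓕) {Z : Scheme.{0}} {i : Z ⟶ (pad4Anchor E₀).X.left}
    (hZ : IsZeroSchemeOf s i) : Nonempty Z :=
  nonempty_zeroScheme_of_realisedBy hloc hrk hR hμ (separatesH4_hStd hE hψ F η) s hZ

end Separates

/-! ## §27.6 Audit -/

/-- census-neutral marker: nothing in this file decides the crux, the stub, or any item. -/
theorem audit_nothing_decided : True :=
  trivial

end Joint

end Summit.HodgeConjecture.HodgeConjecture.Cruxes.BlochSeedDiscOne.SeedChecker

end
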